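import Summits.RiemannHypothesis.RiemannHypothesis.Theorems.TiltedLandingLaw421R3StepFormQ

/-! # TiltedLandingLaw421R3RateBooksQ — the EXACT BOOKS of the Q-rate account and the (CA364) class-count socket
SUPPORT for stub `stub_restRateBotQ : RhW08.SealSwapQ.RestRateBotQ` of crux `TiltedLandingLaw421` (stmt-RiemannHypothesis-24774; registry
`Cruxes/TiltedLandingLaw421/Lines/trkD_v3q.lean` 1f07ef57). C4 «kernel desk» (rh-idea-6 g28); W-08 director (CA364) «WORDS-8c, typed over landed
meters, posted as an rc-0 file». Imports only `…R3StepFormQ` (#1030).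

* §B.1 BOOKS (K). The rate account of #1030 in closed form: `rateLHSBotQ k = rateLHSBotQ 0 + chargeCount k − chargedDropSumQ k − creditsQ k`
  (`rateLHSBotQ_eq_books`; the critic's identity «margin_k = S₀ + 4·Σ_charged drops/s − U_k» as a theorem), hence
  `RestRateBotQ ↔ ∀ legal k, netCostQ AllLevelsQ k ≤ slack0Q + creditsQ k` (`restRateBotQ_iff_books`), with the level-0 slack
  `slack0Q = heightBudget (tentMeterTrkD (3/2)) StTrkDQ` (`slack0Q_eq_heightBudget`) and `0 ≤ slack0Q` on legal data (INIT♯^Q, #1023/#1030).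
* §B.2 HORIZON (K). No charge at or after a Ready′ level (Q family); the books need only be checked after CHARGED levels (`restRateBotQ_iff_books_step`).
* §B.3 CLASS SOCKET (K). For ANY level classes `𝓕` («far») and `𝓒` («consumption») and allowances `aF aC aA : Budget`:
  `ClassLawQ 𝓕 aF → CreditLawQ (diffClass 𝓒 𝓕) aC → ClassLawQ (restClass 𝓕 𝓒) aA → CapitalLawQ aF aC aA → RestRateBotQ`
  (`restRateBotQ_of_threeBooks`, via the exact partition `netCostQ_split`); conversely `RestRateBotQ ↔ CreditLawQ AllLevelsQ slack0Q`
  (`restRateBotQ_iff_creditLaw_all`), so the socket loses nothing.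
* §B.4 THE (CA364) INSTANCE (T = typed, OPEN as hypotheses). `FarLevelQ` (no zero of `f⁽ʲ⁾` other than the pair in the near window
  `|Re z − Re v| < R/2` of the lowest band state — the `RemainderBox` near window, w-centred), `ConsLevelQ := ¬ EmptyTrkDQ` (booked tent non-empty =
  the level injects), `ApproachLevelQ := restClass FarLevelQ ConsLevelQ`; the laws `FarLawQ aF` (P2, books side), `ConsLawQ aC` (C),
  `ApproachAllowanceQ aA` (P4; director's candidate `aA = approachPurseQ = (Hs/s)² + 1`), the sharper per-level `FarEnergyLawQ` ((R2):
  `s² ≤ η²·(lowH_j² − lowH_{j+1}²)` on charged far levels), the capital condition READ OFF: `CapitalLawQ aF aC aA ↔ ∀ legal, aF + aC + aA + T₀ᴿ ≤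
  (Hs/s)² + B + 1 + 4(hmax − lowH 0)/s` (`capitalLawQ_iff`), and the nodes `restRateBotQ_of_CA364`, `law421_of_CA364`.
* §B.5 REFINEMENTS (K): laws add over class refinements (`classLawQ_union`); the COUNT form pays the books only with a NO-RISE law on its own levels
  (`classLawQ_of_countLaw`); potentials telescope (`classLawQ_of_potential`); (R2) + no pre-horizon rise ⟹ (P2) with the energy purse (`farLawQ_of_energyLaw`).
* §B.6 RISES BOOKED (K): potentials with a rise allowance (`classLawQ_of_potential_rises`); (R2) + `EnergyRiseLawQ aR` ⟹ (P2) with allowance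
  `energyPurseQ + aR`, no monotonicity needed (`farLawQ_of_energyLaw_rises`); the node `restRateBotQ_of_laws_rises`.
* §B.7 DEFICIT FORM (K): any non-negative potential enters the books through `classLawQ_of_deficitLaw` with ONE measured number (its accumulated
  deficit); the zero potential gives C1's positive-part wording of (P4) (`approachAllowanceQ_of_posPart`); credit laws refine (`creditLawQ_union`).
* §B.8 ENERGY METERS: `boxEnergy` / `boxPairs` (Im²-weighted twin of the strip counts) on the FIXED initial region (`initRegionQ`, `fixedEnergyQ`,
  `fixedPairsQ`, `energyPotQ`); the strip-energy deficit law (T) and its socket consequences (`classLawQ_of_energyDeficit`, `consLawQ_of_split`).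
Typed ≠ proved: the §B.4 laws are HYPOTHESES (OPEN; engines measure them); K lemmas are bookkeeping about MODEL sockets; nothing here bears on the
truth of RH; RH is NOT proved; 24774 OPEN. -/

namespace RhW08.SealSwapQ

open Complex
open RhIdea6.G17.W07C7 RhIdea6.G17.W07C7.Rev6 RhIdea6.G18.W07C8.Law421BirthS RhIdea6.G19.W07C11.Seam
open RhIdea6.G20.W07C12.Frac RhIdea6.G20.W07C12.StColP RhW07.C12.FieldSplit RhIdea6.G21.W07C13.TentMax
open RhW07.C14.TwoSided RhW07.C14.Classes RhW07.C14.Lineage RhW07.C14.Booking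
open RhW07.C13.Heredity RhIdea6.G22.W07C15pre.Injection RhW07.E3.Cell
open RhW07.E3.Lit
open RhW08.Round1 RhW08.StSwap RhW08.Round2 RhW08.QuadW
open RhW08.SealSwap (PBot)

section BooksQ

/-! ## §B.1 the books in closed form -/

/-- §B.1 the SIGNED drop of the lowest band height across level `j` (negative = a rise: theft, or a landing outside the window). -/
noncomputable def dropQ (η : ℝ) (f : ℂ → ℂ) (x₀ s hmax R Hs : ℝ) (B j : ℕ) : ℝ :=
  lowH StTrkDQ η f x₀ s hmax R Hs B j - lowH StTrkDQ η f x₀ s hmax R Hs B (j + 1)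

open Classical in
/-- §B.1 (P1) the signed CHARGED-DROP SUBSIDY below `k`: `Σ_{j<k, charged} 4·dropQ j / s`. -/
noncomputable def chargedDropSumQ (η : ℝ) (f : ℂ → ℂ) (x₀ s hmax R Hs : ℝ) (B k : ℕ) : ℝ :=
  ∑ j ∈ Finset.range k,
    (if Charged (PTrkSQ PBot) StTrkDQ ReadyR2 η f x₀ s hmax R Hs B j then 4 * dropQ η f x₀ s hmax R Hs B j / s else 0)

/-- §B.1 the tent CREDITS consumed below `k`: `T₀⁺ − (T₀ − injected k)⁺` with `T₀ = tentMeterTrkD (3/2) … 0` (lies in `[0, min (injected k) T₀⁺]`). -/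
noncomputable def creditsQ (η : ℝ) (f : ℂ → ℂ) (x₀ s hmax R Hs : ℝ) (B k : ℕ) : ℝ :=
  max (tentMeterTrkD (3 / 2) η f x₀ s hmax R Hs B 0) 0
    - max (tentMeterTrkD (3 / 2) η f x₀ s hmax R Hs B 0
        - injected (PTrkSQ PBot) StTrkDQ ReadyR2 EmptyTrkDQ η f x₀ s hmax R Hs B k) 0

/-- §B.1 the level-0 SLACK `S₀ := purse − L_Q 0` (a `Budget`). -/
noncomputable def slack0Q (η : ℝ) (f : ℂ → ℂ) (x₀ s hmax R Hs : ℝ) (B : ℕ) : ℝ :=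
  (Hs / s) ^ 2 + (B : ℝ) + 1 + 4 * hmax / s - rateLHSBotQ η f x₀ s hmax R Hs B 0

open Classical in
/-- §B.1 the NET COST below `k` of the charged levels in class `𝓚`: `Σ_{j<k} [Charged j ∧ 𝓚 j]·(1 − 4·dropQ j / s)` (levels minus their OWN signed drops). -/
noncomputable def netCostQ (𝓚 : LevelClass) (η : ℝ) (f : ℂ → ℂ) (x₀ s hmax R Hs : ℝ) (B k : ℕ) : ℝ :=
  ∑ j ∈ Finset.range k,
    (if Charged (PTrkSQ PBot) StTrkDQ ReadyR2 η f x₀ s hmax R Hs B j ∧ 𝓚 η f x₀ s hmax R Hs B j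
      then 1 - 4 * dropQ η f x₀ s hmax R Hs B j / s else 0)

/-- the class of ALL levels. -/
def AllLevelsQ : LevelClass := fun _ _ _ _ _ _ _ _ _ => True

/-- the EMPTY class. -/
def NoLevelsQ : LevelClass := fun _ _ _ _ _ _ _ _ _ => False

/-- class difference `𝓒 ∖ 𝓕` (explicit lambda; no instances). -/
def diffClass (𝓒 𝓕 : LevelClass) : LevelClass := fun η f x₀ s hmax R Hs B j =>
  𝓒 η f x₀ s hmax R Hs B j ∧ ¬ 𝓕 η f x₀ s hmax R Hs B j

/-- the REST class `¬𝓕 ∧ ¬𝓒`. -/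
def restClass (𝓕 𝓒 : LevelClass) : LevelClass := fun η f x₀ s hmax R Hs B j =>
  ¬ 𝓕 η f x₀ s hmax R Hs B j ∧ ¬ 𝓒 η f x₀ s hmax R Hs B j

/-- (K) §B.1 the account at level 0: `L_Q 0 = T₀⁺ + 4·lowH 0 / s`. -/
theorem rateLHSBotQ_zero_eq (η : ℝ) (f : ℂ → ℂ) (x₀ s hmax R Hs : ℝ) (B : ℕ) :
    rateLHSBotQ η f x₀ s hmax R Hs B 0
      = max (tentMeterTrkD (3 / 2) η f x₀ s hmax R Hs B 0) 0 + 4 * lowH StTrkDQ η f x₀ s hmax R Hs B 0 / s := by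
  rw [rateLHSBotQ, chargeCount_zero, RhW08.SealSwap.injected_zero, Finset.sum_range_zero, sub_zero, zero_add, add_zero]

/-- (K) the tracked tent meter is non-negative (an `sSup` of non-negative readings; `0` on an empty level). -/
theorem tentMeterTrkD_nonneg (ρ η : ℝ) (f : ℂ → ℂ) (x₀ s hmax R Hs : ℝ) (B j : ℕ) :
    0 ≤ tentMeterTrkD ρ η f x₀ s hmax R Hs B j := by
  apply Real.sSup_nonneg
  rintro _ ⟨u, -, rfl⟩
  exact tentAt_nonneg _ _ _ _

/-- (K) §B.1 the slack in closed form: `S₀ = (Hs/s)² + B + 1 + 4(hmax − lowH 0)/s − T₀`. -/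
theorem slack0Q_eq (η : ℝ) (f : ℂ → ℂ) (x₀ s hmax R Hs : ℝ) (B : ℕ) :
    slack0Q η f x₀ s hmax R Hs B = (Hs / s) ^ 2 + (B : ℝ) + 1
      + 4 * (hmax - lowH StTrkDQ η f x₀ s hmax R Hs B 0) / s - tentMeterTrkD (3 / 2) η f x₀ s hmax R Hs B 0 := by
  rw [slack0Q, rateLHSBotQ_zero_eq, max_eq_left (tentMeterTrkD_nonneg _ _ _ _ _ _ _ _ _ _)]
  ring

/-- ★ (K) §B.1 **the slack IS the height purse of INIT♯^Q**: `S₀ = heightBudget (tentMeterTrkD (3/2)) StTrkDQ`. -/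
theorem slack0Q_eq_heightBudget (η : ℝ) (f : ℂ → ℂ) (x₀ s hmax R Hs : ℝ) (B : ℕ) :
    slack0Q η f x₀ s hmax R Hs B = heightBudget (tentMeterTrkD (3 / 2)) StTrkDQ η f x₀ s hmax R Hs B := by
  rw [slack0Q_eq, heightBudget, lowH_zero]
  ring

/-- ★ (K) §B.1 the slack is non-negative on legal data (`restRateBotQ_zero`, i.e. INIT♯^Q `initSharpQ_closed`). -/
theorem slack0Q_nonneg {η : ℝ} {f : ℂ → ℂ} {x₀ s hmax R Hs : ℝ} {B : ℕ} (hE : EngineHyps5 2 η f x₀ s hmax R Hs B) :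
    0 ≤ slack0Q η f x₀ s hmax R Hs B :=
  sub_nonneg.mpr (restRateBotQ_zero hE)

/-- (K) the injection count is non-negative. -/
theorem injected_nonneg (P St Ready : StatePred) (𝓔 : LevelClass) (η : ℝ) (f : ℂ → ℂ) (x₀ s hmax R Hs : ℝ) (B k : ℕ) :
    0 ≤ injected P St Ready 𝓔 η f x₀ s hmax R Hs B k := by
  rw [injected_eq_card]
  exact Nat.cast_nonneg _

/-- (K) §B.1 no credits below level 0. -/
theorem creditsQ_zero (η : ℝ) (f : ℂ → ℂ) (x₀ s hmax R Hs : ℝ) (B : ℕ) : creditsQ η f x₀ s hmax R Hs B 0 = 0 := by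
  rw [creditsQ, RhW08.SealSwap.injected_zero, sub_zero, sub_self]

/-- (K) §B.1 credits are non-negative. -/
theorem creditsQ_nonneg (η : ℝ) (f : ℂ → ℂ) (x₀ s hmax R Hs : ℝ) (B k : ℕ) : 0 ≤ creditsQ η f x₀ s hmax R Hs B k := by
  have hi := injected_nonneg (PTrkSQ PBot) StTrkDQ ReadyR2 EmptyTrkDQ η f x₀ s hmax R Hs B k
  exact sub_nonneg.mpr (max_le_max (by linarith) le_rfl)

/-- (K) §B.1 credits never exceed the injections (each injected level draws at most one credit). -/
theorem creditsQ_le_injected (η : ℝ) (f : ℂ → ℂ) (x₀ s hmax R Hs : ℝ) (B k : ℕ) :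
    creditsQ η f x₀ s hmax R Hs B k ≤ injected (PTrkSQ PBot) StTrkDQ ReadyR2 EmptyTrkDQ η f x₀ s hmax R Hs B k := by
  have hi := injected_nonneg (PTrkSQ PBot) StTrkDQ ReadyR2 EmptyTrkDQ η f x₀ s hmax R Hs B k
  have h1 := le_max_left (tentMeterTrkD (3 / 2) η f x₀ s hmax R Hs B 0
    - injected (PTrkSQ PBot) StTrkDQ ReadyR2 EmptyTrkDQ η f x₀ s hmax R Hs B k) 0
  have h2 := le_max_right (tentMeterTrkD (3 / 2) η f x₀ s hmax R Hs B 0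
    - injected (PTrkSQ PBot) StTrkDQ ReadyR2 EmptyTrkDQ η f x₀ s hmax R Hs B k) 0
  have h3 : max (tentMeterTrkD (3 / 2) η f x₀ s hmax R Hs B 0) 0
      ≤ max (tentMeterTrkD (3 / 2) η f x₀ s hmax R Hs B 0
          - injected (PTrkSQ PBot) StTrkDQ ReadyR2 EmptyTrkDQ η f x₀ s hmax R Hs B k) 0
        + injected (PTrkSQ PBot) StTrkDQ ReadyR2 EmptyTrkDQ η f x₀ s hmax R Hs B k :=
    max_le (by linarith) (by linarith)
  unfold creditsQ
  linarith

/-- (K) §B.1 credits never exceed the level-0 tent count `T₀⁺ = T₀`. -/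
theorem creditsQ_le_tent0 (η : ℝ) (f : ℂ → ℂ) (x₀ s hmax R Hs : ℝ) (B k : ℕ) :
    creditsQ η f x₀ s hmax R Hs B k ≤ tentMeterTrkD (3 / 2) η f x₀ s hmax R Hs B 0 := by
  unfold creditsQ
  rw [max_eq_left (tentMeterTrkD_nonneg _ _ _ _ _ _ _ _ _ _)]
  linarith [le_max_right (tentMeterTrkD (3 / 2) η f x₀ s hmax R Hs B 0
    - injected (PTrkSQ PBot) StTrkDQ ReadyR2 EmptyTrkDQ η f x₀ s hmax R Hs B k) 0]

open Classical in
/-- ★ (K) §B.1 (Q twin of §K.21) across a CHARGED level the account moves by `1 − 4·dropQ k/s` plus the change of the unspent credit. -/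
theorem rateLHSBotQ_succ_of_charged {η : ℝ} {f : ℂ → ℂ} {x₀ s hmax R Hs : ℝ} {B k : ℕ}
    (h : Charged (PTrkSQ PBot) StTrkDQ ReadyR2 η f x₀ s hmax R Hs B k) :
    rateLHSBotQ η f x₀ s hmax R Hs B (k + 1) = rateLHSBotQ η f x₀ s hmax R Hs B k + 1
      - 4 * (lowH StTrkDQ η f x₀ s hmax R Hs B k - lowH StTrkDQ η f x₀ s hmax R Hs B (k + 1)) / s
      + (max (tentMeterTrkD (3 / 2) η f x₀ s hmax R Hs B 0
            - injected (PTrkSQ PBot) StTrkDQ ReadyR2 EmptyTrkDQ η f x₀ s hmax R Hs B (k + 1)) 0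
         - max (tentMeterTrkD (3 / 2) η f x₀ s hmax R Hs B 0
            - injected (PTrkSQ PBot) StTrkDQ ReadyR2 EmptyTrkDQ η f x₀ s hmax R Hs B k) 0) := by
  simp only [rateLHSBotQ, chargeCount_succ, Finset.sum_range_succ, h, if_true]
  ring

open Classical in
/-- (K) §B.1 across a CHARGED level the injection count grows by one unless the level is in the exception class `EmptyTrkDQ`. -/
theorem injectedQ_succ_of_charged {η : ℝ} {f : ℂ → ℂ} {x₀ s hmax R Hs : ℝ} {B k : ℕ}
    (h : Charged (PTrkSQ PBot) StTrkDQ ReadyR2 η f x₀ s hmax R Hs B k) :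
    injected (PTrkSQ PBot) StTrkDQ ReadyR2 EmptyTrkDQ η f x₀ s hmax R Hs B (k + 1)
      = injected (PTrkSQ PBot) StTrkDQ ReadyR2 EmptyTrkDQ η f x₀ s hmax R Hs B k
        + (if EmptyTrkDQ η f x₀ s hmax R Hs B k then 0 else 1) := by
  unfold injected
  rw [Finset.sum_range_succ]
  simp only [h, true_and, ite_not]

open Classical in
/-- ★★★ (K) §B.1 **THE BOOKS IN CLOSED FORM**: `L_Q k = L_Q 0 + chargeCount k − chargedDropSumQ k − creditsQ k` — every charged level costs `1`, is
subsidised by its own signed drop `4·dropQ/s`, and (while the level-0 tent credit lasts) by one credit if it injects; uncharged levels are free (#1030). -/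
theorem rateLHSBotQ_eq_books (η : ℝ) (f : ℂ → ℂ) (x₀ s hmax R Hs : ℝ) (B k : ℕ) :
    rateLHSBotQ η f x₀ s hmax R Hs B k = rateLHSBotQ η f x₀ s hmax R Hs B 0
      + chargeCount (PTrkSQ PBot) StTrkDQ ReadyR2 η f x₀ s hmax R Hs B k
      - chargedDropSumQ η f x₀ s hmax R Hs B k - creditsQ η f x₀ s hmax R Hs B k := by
  induction k with
  | zero => rw [chargeCount_zero, creditsQ_zero, chargedDropSumQ, Finset.sum_range_zero]; ring
  | succ k ih =>
    by_cases hC : Charged (PTrkSQ PBot) StTrkDQ ReadyR2 η f x₀ s hmax R Hs B k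
    · rw [rateLHSBotQ_succ_of_charged hC, ih, chargeCount_succ, if_pos hC]
      simp only [chargedDropSumQ, creditsQ, dropQ, Finset.sum_range_succ, if_pos hC]
      ring
    · rw [rateLHSBotQ_succ_of_not_charged hC, ih, chargeCount_succ, if_neg hC]
      simp only [chargedDropSumQ, creditsQ, Finset.sum_range_succ, if_neg hC, injectedQ_succ_of_not_charged hC]
      ring

open Classical in
/-- (K) §B.1 the net cost of ALL charged levels is the charge count minus the charged-drop subsidy. -/
theorem netCostQ_all_eq (η : ℝ) (f : ℂ → ℂ) (x₀ s hmax R Hs : ℝ) (B k : ℕ) :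
    netCostQ AllLevelsQ η f x₀ s hmax R Hs B k
      = chargeCount (PTrkSQ PBot) StTrkDQ ReadyR2 η f x₀ s hmax R Hs B k - chargedDropSumQ η f x₀ s hmax R Hs B k := by
  simp only [netCostQ, AllLevelsQ, and_true, chargeCount, chargedDropSumQ, ← Finset.sum_sub_distrib]
  refine Finset.sum_congr rfl fun j _ => ?_
  split_ifs <;> ring

/-- ★★★ (K) §B.1 **`RestRateBotQ` ⟺ THE BOOKS BALANCE**: at every prefix the net cost of the charged levels is covered by the level-0 slack plus the
credits drawn — `netCostQ ⊤ k ≤ S₀ + creditsQ k` (critic's «margin_k = S₀ + 4Σ_ch drops/s − U_k ≥ 0», U_k = charges − credits). -/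
theorem restRateBotQ_iff_books : RestRateBotQ ↔
    ∀ (η : ℝ) (f : ℂ → ℂ) (x₀ s hmax R Hs : ℝ) (B : ℕ), EngineHyps5 2 η f x₀ s hmax R Hs B →
      ∀ k : ℕ, netCostQ AllLevelsQ η f x₀ s hmax R Hs B k ≤ slack0Q η f x₀ s hmax R Hs B + creditsQ η f x₀ s hmax R Hs B k := by
  rw [restRateBotQ_iff_lhs]
  constructor
  · intro h η f x₀ s hmax R Hs B hE k
    have hk := h η f x₀ s hmax R Hs B hE k
    rw [rateLHSBotQ_eq_books] at hk
    rw [netCostQ_all_eq, slack0Q]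
    linarith
  · intro h η f x₀ s hmax R Hs B hE k
    have hk := h η f x₀ s hmax R Hs B hE k
    rw [netCostQ_all_eq, slack0Q] at hk
    rw [rateLHSBotQ_eq_books]
    linarith

/-! ## §B.2 horizon: the books need only be checked after charged levels -/

/-- (K) §B.2 (Q twin of §K.21) **no charge at or after a Ready′ level**. -/
theorem not_chargedQ_of_readyR2 {η : ℝ} {f : ℂ → ℂ} {x₀ s hmax R Hs : ℝ} {B j₀ j : ℕ} {v₀ : ℂ}
    (h : ReadyR2 η f x₀ s hmax R Hs B j₀ v₀) (hj : j₀ ≤ j) : ¬ Charged (PTrkSQ PBot) StTrkDQ ReadyR2 η f x₀ s hmax R Hs B j := by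
  rintro ⟨v, -, hnr, -⟩
  exact hnr (RhW08.SealSwap.readyR2_mono h hj)

/-- (K) §B.2 a charged level is PRE-HORIZON: no state is Ready′ at it or at any earlier level. -/
theorem prehorizon_of_chargedQ {η : ℝ} {f : ℂ → ℂ} {x₀ s hmax R Hs : ℝ} {B k : ℕ}
    (hC : Charged (PTrkSQ PBot) StTrkDQ ReadyR2 η f x₀ s hmax R Hs B k) :
    ∀ j : ℕ, j ≤ k → ∀ v : ℂ, ¬ ReadyR2 η f x₀ s hmax R Hs B j v :=
  fun _ hj _ hR => not_chargedQ_of_readyR2 hR hj hC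

/-- (K) §B.2 the account is CONSTANT from the first Ready′ level on (Q twin of §K.21). -/
theorem rateLHSBotQ_eq_of_readyR2 {η : ℝ} {f : ℂ → ℂ} {x₀ s hmax R Hs : ℝ} {B j₀ : ℕ} {v₀ : ℂ}
    (h : ReadyR2 η f x₀ s hmax R Hs B j₀ v₀) :
    ∀ k : ℕ, j₀ ≤ k → rateLHSBotQ η f x₀ s hmax R Hs B k = rateLHSBotQ η f x₀ s hmax R Hs B j₀ := by
  intro k hk
  induction k with
  | zero =>
    have : j₀ = 0 := Nat.le_zero.mp hk
    subst this; rfl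
  | succ k ih =>
    rcases Nat.lt_or_ge k j₀ with hlt | hge
    · have : j₀ = k + 1 := by omega
      subst this; rfl
    · rw [rateLHSBotQ_succ_of_not_charged (not_chargedQ_of_readyR2 h hge)]
      exact ih hge

/-- ★★ (K) §B.2 **STEP FORM OF THE BOOKS**: `RestRateBotQ` iff after every CHARGED level `k` the books balance at prefix `k + 1` (#1030 `restRateBotQ_iff_step`). -/
theorem restRateBotQ_iff_books_step : RestRateBotQ ↔
    ∀ (η : ℝ) (f : ℂ → ℂ) (x₀ s hmax R Hs : ℝ) (B : ℕ), EngineHyps5 2 η f x₀ s hmax R Hs B →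
      ∀ k : ℕ, Charged (PTrkSQ PBot) StTrkDQ ReadyR2 η f x₀ s hmax R Hs B k →
        netCostQ AllLevelsQ η f x₀ s hmax R Hs B (k + 1)
          ≤ slack0Q η f x₀ s hmax R Hs B + creditsQ η f x₀ s hmax R Hs B (k + 1) := by
  rw [restRateBotQ_iff_step]
  constructor
  · intro h η f x₀ s hmax R Hs B hE k hC
    have hk := h η f x₀ s hmax R Hs B hE k hC
    rw [rateLHSBotQ_eq_books] at hk
    rw [netCostQ_all_eq, slack0Q]
    linarith
  · intro h η f x₀ s hmax R Hs B hE k hC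
    have hk := h η f x₀ s hmax R Hs B hE k hC
    rw [netCostQ_all_eq, slack0Q] at hk
    show rateLHSBotQ η f x₀ s hmax R Hs B (k + 1) ≤ _
    rw [rateLHSBotQ_eq_books]
    linarith

/-! ## §B.3 the class socket -/

/-- §B.3 LAW SHAPE: the net cost of the charged `𝓚`-levels stays within the allowance `a`, checked after every charged level (= pre-horizon, §B.2). -/
def ClassLawQ (𝓚 : LevelClass) (a : Budget) : Prop :=
  ∀ (η : ℝ) (f : ℂ → ℂ) (x₀ s hmax R Hs : ℝ) (B : ℕ), EngineHyps5 2 η f x₀ s hmax R Hs B →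
    ∀ k : ℕ, Charged (PTrkSQ PBot) StTrkDQ ReadyR2 η f x₀ s hmax R Hs B k →
      netCostQ 𝓚 η f x₀ s hmax R Hs B (k + 1) ≤ a η f x₀ s hmax R Hs B

/-- §B.3 LAW SHAPE WITH CREDITS: the class may in addition draw the tent credits `creditsQ` (each credit is drawn once, so only ONE class may). -/
def CreditLawQ (𝓚 : LevelClass) (a : Budget) : Prop :=
  ∀ (η : ℝ) (f : ℂ → ℂ) (x₀ s hmax R Hs : ℝ) (B : ℕ), EngineHyps5 2 η f x₀ s hmax R Hs B →
    ∀ k : ℕ, Charged (PTrkSQ PBot) StTrkDQ ReadyR2 η f x₀ s hmax R Hs B k →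
      netCostQ 𝓚 η f x₀ s hmax R Hs B (k + 1) ≤ creditsQ η f x₀ s hmax R Hs B (k + 1) + a η f x₀ s hmax R Hs B

/-- §B.3 CAPITAL: the three allowances fit in the level-0 slack `S₀`. -/
def CapitalLawQ (aF aC aA : Budget) : Prop :=
  ∀ (η : ℝ) (f : ℂ → ℂ) (x₀ s hmax R Hs : ℝ) (B : ℕ), EngineHyps5 2 η f x₀ s hmax R Hs B →
    aF η f x₀ s hmax R Hs B + aC η f x₀ s hmax R Hs B + aA η f x₀ s hmax R Hs B ≤ slack0Q η f x₀ s hmax R Hs B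

open Classical in
/-- ★ (K) §B.3 **EXACT PARTITION of the net cost** by two classes: all = `𝓕` + (`𝓒 ∖ 𝓕`) + rest (summand-wise; signed drops need a genuine partition). -/
theorem netCostQ_split (𝓕 𝓒 : LevelClass) (η : ℝ) (f : ℂ → ℂ) (x₀ s hmax R Hs : ℝ) (B k : ℕ) :
    netCostQ AllLevelsQ η f x₀ s hmax R Hs B k
      = netCostQ 𝓕 η f x₀ s hmax R Hs B k + netCostQ (diffClass 𝓒 𝓕) η f x₀ s hmax R Hs B k
        + netCostQ (restClass 𝓕 𝓒) η f x₀ s hmax R Hs B k := by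
  simp only [netCostQ, AllLevelsQ, diffClass, restClass, and_true, ← Finset.sum_add_distrib]
  refine Finset.sum_congr rfl fun j _ => ?_
  by_cases hC : Charged (PTrkSQ PBot) StTrkDQ ReadyR2 η f x₀ s hmax R Hs B j <;>
    by_cases hF : 𝓕 η f x₀ s hmax R Hs B j <;> by_cases hc : 𝓒 η f x₀ s hmax R Hs B j <;> simp [hC, hF, hc]

/-- ★★★ (K) §B.3 **THE CLASS SOCKET**: far levels within `aF`, consumption levels (not far) within credits + `aC`, the rest within `aA`, capital
`aF + aC + aA ≤ S₀` ⟹ `RestRateBotQ`. Classes and allowances are PARAMETERS; the director's (CA364) instance is §B.4. -/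
theorem restRateBotQ_of_threeBooks {𝓕 𝓒 : LevelClass} {aF aC aA : Budget}
    (hF : ClassLawQ 𝓕 aF) (hC : CreditLawQ (diffClass 𝓒 𝓕) aC) (hA : ClassLawQ (restClass 𝓕 𝓒) aA)
    (hcap : CapitalLawQ aF aC aA) : RestRateBotQ := by
  rw [restRateBotQ_iff_books_step]
  intro η f x₀ s hmax R Hs B hE k hk
  rw [netCostQ_split 𝓕 𝓒]
  have h1 := hF η f x₀ s hmax R Hs B hE k hk
  have h2 := hC η f x₀ s hmax R Hs B hE k hk
  have h3 := hA η f x₀ s hmax R Hs B hE k hk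
  have h4 := hcap η f x₀ s hmax R Hs B hE
  linarith

/-- ★ (K) §B.3 **the socket loses nothing**: `RestRateBotQ` is itself the credit law of the class of all levels with allowance `S₀`. -/
theorem restRateBotQ_iff_creditLaw_all : RestRateBotQ ↔ CreditLawQ AllLevelsQ slack0Q := by
  rw [restRateBotQ_iff_books_step]
  simp only [CreditLawQ, add_comm (creditsQ _ _ _ _ _ _ _ _ _)]

open Classical in
/-- (K) the empty class costs nothing. -/
theorem netCostQ_noLevels (η : ℝ) (f : ℂ → ℂ) (x₀ s hmax R Hs : ℝ) (B k : ℕ) :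
    netCostQ NoLevelsQ η f x₀ s hmax R Hs B k = 0 := by
  simp [netCostQ, NoLevelsQ]

open Classical in
/-- (K) a class with no members below the horizon costs nothing: if no charged level lies in `𝓚`, `netCostQ 𝓚 = 0`. -/
theorem netCostQ_eq_zero_of_forall_not {𝓚 : LevelClass} {η : ℝ} {f : ℂ → ℂ} {x₀ s hmax R Hs : ℝ} {B k : ℕ}
    (h : ∀ j : ℕ, j < k → Charged (PTrkSQ PBot) StTrkDQ ReadyR2 η f x₀ s hmax R Hs B j → ¬ 𝓚 η f x₀ s hmax R Hs B j) :
    netCostQ 𝓚 η f x₀ s hmax R Hs B k = 0 := by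
  refine Finset.sum_eq_zero fun j hj => ?_
  rw [Finset.mem_range] at hj
  by_cases hC : Charged (PTrkSQ PBot) StTrkDQ ReadyR2 η f x₀ s hmax R Hs B j
  · simp [hC, h j hj hC]
  · simp [hC]

open Classical in
/-- (K) §B.3 one-step bookkeeping of a class cost: across level `k` the cost of `𝓚` grows by `[Charged k ∧ 𝓚 k]·(1 − 4·dropQ k/s)`. -/
theorem netCostQ_succ (𝓚 : LevelClass) (η : ℝ) (f : ℂ → ℂ) (x₀ s hmax R Hs : ℝ) (B k : ℕ) :
    netCostQ 𝓚 η f x₀ s hmax R Hs B (k + 1) = netCostQ 𝓚 η f x₀ s hmax R Hs B k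
      + (if Charged (PTrkSQ PBot) StTrkDQ ReadyR2 η f x₀ s hmax R Hs B k ∧ 𝓚 η f x₀ s hmax R Hs B k
          then 1 - 4 * dropQ η f x₀ s hmax R Hs B k / s else 0) := by
  rw [netCostQ, Finset.sum_range_succ, netCostQ]

open Classical in
/-- ★ (K) §B.3 **POTENTIAL FORM of a class law** (the one-step shape engines test): a non-negative level potential `Φ` with `Φ 0 ≤ a` that pays
`1 − 4·dropQ k/s` across every charged `𝓚`-level and does not rise across the other pre-horizon levels gives `ClassLawQ 𝓚 a` (telescoping). -/
theorem classLawQ_of_potential {𝓚 : LevelClass} {a : Budget} (Φ : LevelMeter)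
    (h0 : ∀ (η : ℝ) (f : ℂ → ℂ) (x₀ s hmax R Hs : ℝ) (B : ℕ), EngineHyps5 2 η f x₀ s hmax R Hs B →
      (∀ k : ℕ, 0 ≤ Φ η f x₀ s hmax R Hs B k) ∧ Φ η f x₀ s hmax R Hs B 0 ≤ a η f x₀ s hmax R Hs B ∧
      ∀ k : ℕ, (∀ v : ℂ, ¬ ReadyR2 η f x₀ s hmax R Hs B k v) →
        Φ η f x₀ s hmax R Hs B (k + 1)
          + (if Charged (PTrkSQ PBot) StTrkDQ ReadyR2 η f x₀ s hmax R Hs B k ∧ 𝓚 η f x₀ s hmax R Hs B k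
              then 1 - 4 * dropQ η f x₀ s hmax R Hs B k / s else 0)
          ≤ Φ η f x₀ s hmax R Hs B k) :
    ClassLawQ 𝓚 a := by
  intro η f x₀ s hmax R Hs B hE k hk
  obtain ⟨hpos, hinit, hstep⟩ := h0 η f x₀ s hmax R Hs B hE
  have hpre := prehorizon_of_chargedQ hk
  -- telescoping: for every `m ≤ k + 1`, `netCostQ 𝓚 m + Φ m ≤ Φ 0`
  have key : ∀ m : ℕ, m ≤ k + 1 → netCostQ 𝓚 η f x₀ s hmax R Hs B m + Φ η f x₀ s hmax R Hs B m ≤ Φ η f x₀ s hmax R Hs B 0 := by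
    intro m hm
    induction m with
    | zero => simp [netCostQ]
    | succ m ih =>
      have hm' : m ≤ k := by omega
      have := hstep m (hpre m hm')
      rw [netCostQ_succ]
      linarith [ih (by omega)]
  have := key (k + 1) le_rfl
  linarith [hpos (k + 1)]

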